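import Literature.AnabelianGeometry.SemiGraphs.TemperedSpecialFibreTower
import Literature.AnabelianGeometry.SemiGraphs.TemperedOpenMapping
import Literature.AnabelianGeometry.SemiGraphs.TemperoidChartNonVacuity
import HarnessLib

/-!
# [SemiAnbd] Example 3.10, the temperoid-level clauses (PRIMS p. 269 l. 13–28 = kurims p. 44):
# "we obtain temperoids `B^temp(Π)`, `B^temp(Δ)`" and "a natural full embedding `B^temp(𝒢) ↪ B^temp(Δ)`"

Mochizuki, *Semi-graphs of anabelioids*, Publ. RIMS **42** (2006), Example 3.10, PRIMS pp. 268–270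
(kurims manuscript pp. 43–45) [cite: MochizukiSemiAnbd2006, Ex 3.10 pp.43-45].

PROOF-ONLY companion of the FROZEN interface files `TemperedCurves.lean` (`TemperedArithmeticGroup`,
node SemiAnbd:Ex3.10, p405241) and `TemperedSpecialFibre.lean` (`SpecialFibreData`): no `def`, no
instance, no new `Prop`; nothing in the parent files is edited or restated.  It supplies kernel
witnesses, BY NAME over the frozen fields, for three printed clauses of Example 3.10 that so far had
no declaration of their own (cell abc-iut, W6 verify row SemiAnbd:Ex3.10, per-node clause coverage):

* p. 268 l. −8 – −6 / p. 269 l. 13–16: "`π₁^temp(X^log_K)` is a tempered topological group … Note that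
  `Δ` is also tempered, so we obtain temperoids `B^temp(Π)`; `B^temp(Δ)`" —
  `TemperedArithmeticGroup.isConnectedTemperoid_bTemp_pi` / `_delta` (Def. 3.1 (ii): `B^temp` of a
  tempered group is a connected temperoid, chart = the identity equivalence) and the `IsTemperoid`
  forms, from the fields `isTempered`, `isTempered_ker`;
* p. 268 l. −6 – −4: "fits into a natural exact sequence `1 → π₁^temp(X^log_K̄) → π₁^temp(X^log_K) →
  G_K → 1`" as an exact sequence of TOPOLOGICAL groups: `Π/Δ ≅ G_K` is a homeomorphism
  (`TemperedArithmeticGroup.isHomeomorph_quotientDeltaEquiv`), by the open mapping theorem for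
  tempered groups (`augIsOpenMap_holds`, `TemperedOpenMapping.lean`);
* p. 269 l. 25–28: "it follows from the definitions that we have … a natural full embedding
  `B^temp(𝒢) ↪ B^temp(Δ)`" — the interface records this (pp. 45, 48 "the natural quotient
  `Δ ↠ π₁^temp(𝒢) ≅ π₁^temp(𝒢^c)`") as the continuous surjection `SpecialFibreData.admissible`; here
  the temperoid-level statement is DERIVED: for any continuous SURJECTIVE homomorphism `φ : Π₁ ↠ Π₂`
  the pull-back functor `B^temp(φ) : B^temp(Π₂) ⥤ B^temp(Π₁)` (§3 p. 34, `BTemp.res`) is full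
  (`BTemp.res_full_of_surjective`) and it is faithful for every `φ` (`BTemp.res_faithful`); whence
  `B^temp(𝒢^c) ≌ B^temp(π₁^temp(𝒢^c)) ⥤ B^temp(Δ)` is full and faithful
  (`SpecialFibreData.fullEmbedding_full` / `_faithful`), and likewise at every level of a special-fibre
  tower (`SpecialFibreTower.res_adm_full` / `_faithful`: `B^temp(𝒢_i) ↪ B^temp(N_i)`).

Not covered here (recorded so nothing is silently dropped): the natural EQUIVALENCE
`B^temp(𝒢) ⥲ B^temp(𝒢^c)` (p. 269 l. 25–27; `𝒢` = `𝒢^c` with the open edges deleted — the tree has no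
open-edge-deletion operation on `ProfiniteSemiGraph`, cf. plan/L3/SUBDAG-SemiAnbd-Ex310.md row X1) and
the semi-graph-level generalized morphisms `𝒢_i → 𝒢_j` of Def. 2.11 (p. 269 l. 45 – p. 270 l. 22).
Refereed pre-IUT material (2006); nothing here bears on [IUTchIII] Cor. 3.12; typed ≠ discharged for
the origin-parametrised statements (`Ex310TowerStatement`).
-/

noncomputable section

namespace Literature.AnabelianGeometry.SemiGraphs

open CategoryTheory Topology

universe u

/-! ### `B^temp(φ)` is faithful, and full for surjective `φ` -/

namespace BTemp

section Res

variable {G₁ : Type u} [Group G₁] [TopologicalSpace G₁] {G₂ : Type u} [Group G₂]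
  [TopologicalSpace G₂]

/-- Equivariance of a morphism of `Π`-sets on elements. [folklore] -/
private theorem hom_apply_ρ {G : Type u} [Group G] {X Y : Action (Type u) G} (f : X ⟶ Y) (g : G)
    (x : X.V) : f.hom (X.ρ g x) = Y.ρ g (f.hom x) := by
  have h := congrArg (fun t => t x) (f.comm g)
  simpa [types_comp_apply] using h

/-- **`B^temp(φ)` is faithful** for every continuous homomorphism `φ : Π₁ → Π₂` ([SemiAnbd] §3 p. 34:
"any continuous homomorphism `Π → Π'` determines [by composing the action …] a morphism of connected
temperoids"): the pull-back functor does not change underlying maps of `Π₂`-sets.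
[cite: MochizukiSemiAnbd2006, Rmk 3.1.2 pp.33-34] -/
theorem res_faithful (φ : G₁ →ₜ* G₂) : (BTemp.res φ).Faithful :=
  ⟨fun {X Y} f g h => by
    apply ObjectProperty.hom_ext
    apply Action.Hom.ext
    exact congrArg (fun t => t.hom.hom) h⟩

/-- **`B^temp(φ)` is full for SURJECTIVE `φ : Π₁ ↠ Π₂`**: a map of underlying sets that is
`Π₁`-equivariant for the actions through `φ` is `Π₂`-equivariant, every element of `Π₂` being a
`φ a`.  This is the group-theoretic content of "a natural full embedding `B^temp(𝒢) ↪ B^temp(Δ)`"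
([SemiAnbd] Ex. 3.10, PRIMS p. 269 l. 27–28) along "the natural quotient `Δ ↠ π₁^temp(𝒢)`" (p. 48).
[cite: MochizukiSemiAnbd2006, Ex 3.10 p.44] -/
theorem res_full_of_surjective (φ : G₁ →ₜ* G₂) (hφ : Function.Surjective φ) :
    (BTemp.res φ).Full :=
  ⟨fun {X Y} f => by
    refine ⟨homOfEquivariant X Y (fun x => f.hom.hom x) (fun g x => ?_), ?_⟩
    · obtain ⟨a, rfl⟩ := hφ g
      exact hom_apply_ρ f.hom a x
    · apply ObjectProperty.hom_ext
      apply Action.Hom.ext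
      exact ConcreteCategory.hom_ext _ _ fun x => rfl⟩

end Res

end BTemp

/-! ### Example 3.10 (p. 268 / p. 269 l. 13–16): `B^temp(Π)`, `B^temp(Δ)` are (connected) temperoids;
the exact sequence `1 → Δ → Π → G_K → 1` is one of topological groups -/

/-- **Def. 3.1 (ii): `B^temp(Π)` is a connected temperoid** for every tempered topological group `Π`
(chart = the identity equivalence). [cite: MochizukiSemiAnbd2006, Def 3.1(ii) p.33] -/
theorem isConnectedTemperoid_bTemp (G : Type u) [Group G] [TopologicalSpace G] [IsTopologicalGroup G]
    (hG : IsTempered G) : IsConnectedTemperoid.{u, u, u + 1} (BTemp G) :=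
  ⟨{ G := G, isTempered := hG, equiv := CategoryTheory.Equivalence.refl }⟩

namespace TemperedArithmeticGroup

variable {K : Type u} [Field K] (D : TemperedArithmeticGroup K)

/-- **"`π₁^temp(X^log_K)` is a tempered topological group … we obtain [the] temperoid `B^temp(Π)`"**
([SemiAnbd] Ex. 3.10, PRIMS p. 268 / p. 269 l. 13–14): `B^temp(Π)` is a connected temperoid
(Def. 3.1 (ii)), by the interface field `isTempered` and the identity chart.
[cite: MochizukiSemiAnbd2006, Ex 3.10 pp.43-44] -/
theorem isConnectedTemperoid_bTemp_pi : IsConnectedTemperoid.{u, u, u + 1} (BTemp D.Pi) :=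
  isConnectedTemperoid_bTemp D.Pi D.isTempered

/-- `B^temp(Π)` is a temperoid ([SemiAnbd] Ex. 3.10 p. 44 "we obtain temperoids `B^temp(Π)`; …").
[cite: MochizukiSemiAnbd2006, Ex 3.10 p.44] -/
theorem isTemperoid_bTemp_pi : IsTemperoid.{u, u, u + 1} (BTemp D.Pi) :=
  isTemperoid_bTemp D.Pi D.isTempered

/-- **"Note that `Δ` is also tempered, so we obtain [the] temperoid … `B^temp(Δ)`"** ([SemiAnbd]
Ex. 3.10, PRIMS p. 269 l. 13–16): `B^temp(Δ)` is a connected temperoid, by the interface field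
`isTempered_ker` (`Δ = Ker(Π → G_K) = D.delta`) and the identity chart.
[cite: MochizukiSemiAnbd2006, Ex 3.10 p.44] -/
theorem isConnectedTemperoid_bTemp_delta : IsConnectedTemperoid.{u, u, u + 1} (BTemp D.delta) :=
  isConnectedTemperoid_bTemp D.delta D.isTempered_ker

/-- `B^temp(Δ)` is a temperoid ([SemiAnbd] Ex. 3.10 p. 44 "we obtain temperoids …; `B^temp(Δ)`").
[cite: MochizukiSemiAnbd2006, Ex 3.10 p.44] -/
theorem isTemperoid_bTemp_delta : IsTemperoid.{u, u, u + 1} (BTemp D.delta) :=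
  isTemperoid_bTemp D.delta D.isTempered_ker

/-- The abstract isomorphism `Π/Δ ≃ G_K` of the interface (`quotientDeltaEquiv`) is, pointwise, the map
induced by the augmentation. [cite: MochizukiSemiAnbd2006, Ex 3.10 p.43] -/
theorem quotientDeltaEquiv_mk (g : D.Pi) : D.quotientDeltaEquiv (g : D.Pi ⧸ D.delta) = D.aug g := rfl

/-- **"fits into a natural exact sequence `1 → π₁^temp(X^log_K̄) → π₁^temp(X^log_K) → G_K → 1`"**
([SemiAnbd] Ex. 3.10, PRIMS p. 268 l. −6 – −4) as an exact sequence of TOPOLOGICAL groups: the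
isomorphism `Π/Δ ≃ G_K` (`quotientDeltaEquiv`, `Π/Δ` with the quotient topology) is a homeomorphism —
continuity from that of the augmentation, openness by the open mapping theorem for tempered groups
(`augIsOpenMap_holds`). [cite: MochizukiSemiAnbd2006, Ex 3.10 p.43] -/
theorem isHomeomorph_quotientDeltaEquiv : IsHomeomorph D.quotientDeltaEquiv := by
  have hmk : IsOpenQuotientMap (QuotientGroup.mk : D.Pi → D.Pi ⧸ D.delta) :=
    QuotientGroup.isOpenQuotientMap_mk
  have hcomp : (fun q : D.Pi ⧸ D.delta => D.quotientDeltaEquiv q) ∘ (QuotientGroup.mk : D.Pi → _) =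
      fun g => D.aug g := by
    funext g
    exact D.quotientDeltaEquiv_mk g
  have hcont : Continuous D.quotientDeltaEquiv := by
    rw [hmk.isQuotientMap.continuous_iff, hcomp]
    exact D.aug.continuous
  have hopen : IsOpenMap D.quotientDeltaEquiv := by
    intro U hU
    have hU' : IsOpen ((QuotientGroup.mk : D.Pi → D.Pi ⧸ D.delta) ⁻¹' U) := hU.preimage hmk.continuous
    have himg : (D.quotientDeltaEquiv : D.Pi ⧸ D.delta → Field.absoluteGaloisGroup K) '' U =
        (fun g => D.aug g) '' ((QuotientGroup.mk : D.Pi → D.Pi ⧸ D.delta) ⁻¹' U) := by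
      rw [← hcomp, Set.image_comp, Set.image_preimage_eq U hmk.surjective]
    rw [himg]
    exact D.augIsOpenMap_holds _ hU'
  exact IsHomeomorph.mk hcont hopen D.quotientDeltaEquiv.bijective

end TemperedArithmeticGroup

/-! ### Example 3.10 (p. 269 l. 25–28): the natural full embedding `B^temp(𝒢) ↪ B^temp(Δ)` -/

namespace SpecialFibreData

variable {K : Type u} [Field K] {D : TemperedArithmeticGroup K} (S : SpecialFibreData D)

/-- Pull-back along "the natural quotient `Δ ↠ π₁^temp(𝒢) ≅ π₁^temp(𝒢^c)`" (pp. 45, 48; the field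
`admissible`) is a FULL functor `B^temp(π₁^temp(𝒢^c)) ⥤ B^temp(Δ)` ([SemiAnbd] Ex. 3.10, PRIMS p. 269
l. 27–28 "a natural full embedding `B^temp(𝒢) ↪ B^temp(Δ)`"). [cite: MochizukiSemiAnbd2006, Ex 3.10 p.44] -/
theorem res_admissible_full : (BTemp.res S.admissible).Full :=
  BTemp.res_full_of_surjective S.admissible S.admissible_surjective

/-- … and a FAITHFUL one. [cite: MochizukiSemiAnbd2006, Ex 3.10 p.44] -/
theorem res_admissible_faithful : (BTemp.res S.admissible).Faithful :=
  BTemp.res_faithful S.admissible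

/-- **"a natural full embedding `B^temp(𝒢) ↪ B^temp(Δ)`"** ([SemiAnbd] Ex. 3.10, PRIMS p. 269 l. 27–28),
with the chart: the composite `B^temp(𝒢^c) ≌ B^temp(π₁^temp(𝒢^c)) ⥤ B^temp(Δ)` of the chart equivalence
(Prop. 3.6 (ii)) with pull-back along the admissible quotient is FULL.
[cite: MochizukiSemiAnbd2006, Ex 3.10 p.44] -/
theorem fullEmbedding_full : (S.chart.equiv.functor ⋙ BTemp.res S.admissible).Full := by
  haveI := S.res_admissible_full
  infer_instance

/-- … and FAITHFUL — so `B^temp(𝒢^c) ⥤ B^temp(Δ)` is a full embedding.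
[cite: MochizukiSemiAnbd2006, Ex 3.10 p.44] -/
theorem fullEmbedding_faithful : (S.chart.equiv.functor ⋙ BTemp.res S.admissible).Faithful := by
  haveI := S.res_admissible_faithful
  infer_instance

end SpecialFibreData

/-! ### The same at every level of a special-fibre tower (p. 270 l. 23–26) -/

namespace SpecialFibreTower

variable {Δ : Type u} [Group Δ] [TopologicalSpace Δ] (T : SpecialFibreTower Δ)

/-- At level `i` of a special-fibre tower, pull-back along the admissible quotient
`N_i ↠ π₁^temp(𝒢_i)` is a full functor `B^temp(π₁^temp(𝒢_i)) ⥤ B^temp(N_i)` ([SemiAnbd] Ex. 3.10,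
PRIMS p. 270 l. 23–26: "these generalized morphisms … induce — by applying '`B^temp(−)`' — natural
morphisms of temperoids … compatible with the actions"). [cite: MochizukiSemiAnbd2006, Ex 3.10 p.45] -/
theorem res_adm_full (i : ℕ) : (BTemp.res (T.adm i)).Full :=
  BTemp.res_full_of_surjective (T.adm i) (T.adm_surjective i)

/-- … and faithful. [cite: MochizukiSemiAnbd2006, Ex 3.10 p.45] -/
theorem res_adm_faithful (i : ℕ) : (BTemp.res (T.adm i)).Faithful :=
  BTemp.res_faithful (T.adm i)

/-- With the chart: `B^temp(𝒢_i) ≌ B^temp(π₁^temp(𝒢_i)) ⥤ B^temp(N_i)` is full.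
[cite: MochizukiSemiAnbd2006, Ex 3.10 p.45] -/
theorem fullEmbedding_full (i : ℕ) : ((T.chart i).equiv.functor ⋙ BTemp.res (T.adm i)).Full := by
  haveI := T.res_adm_full i
  infer_instance

/-- … and faithful. [cite: MochizukiSemiAnbd2006, Ex 3.10 p.45] -/
theorem fullEmbedding_faithful (i : ℕ) :
    ((T.chart i).equiv.functor ⋙ BTemp.res (T.adm i)).Faithful := by
  haveI := T.res_adm_faithful i
  infer_instance

end SpecialFibreTower

end Literature.AnabelianGeometry.SemiGraphs

end
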